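import Mathlib.Algebra.MvPolynomial.CommRing
import Mathlib.Algebra.MvPolynomial.Degrees
import Mathlib.RingTheory.MvPolynomial.Basic
import Mathlib.Data.Finsupp.Weight
import Mathlib.Data.Fin.Tuple.Basic
import Mathlib.LinearAlgebra.Matrix.Charpoly.Basic
import Mathlib.LinearAlgebra.Matrix.ToLinearEquiv
import Literature.RingTheory.KrullDimension.AffineCatenary
import Mathlib.RingTheory.Nullstellensatz
import Mathlib.RingTheory.Ideal.KrullsHeightTheorem
import Mathlib.RingTheory.KrullDimension.Polynomial
import Mathlib.RingTheory.KrullDimension.Field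
import Mathlib.RingTheory.Ideal.MinimalPrime.Basic
import Mathlib.LinearAlgebra.Matrix.Charpoly.Coeff
import Mathlib.FieldTheory.IsAlgClosed.Basic
import Mathlib.Algebra.Polynomial.Roots
import Mathlib.Algebra.MvPolynomial.Funext
import HarnessLib

/-!
# Triangular rewriting, the perturbed characteristic polynomial of a square polynomial system,
# the limit lemma and a Bézout-type count (Canny's generalised characteristic polynomial, made
# elementary)

Topic: `Literature/RingTheory/Elimination`. This file is the algebraic core of an elementary route
to the degree/counting/height bounds for zero-dimensional polynomial systems that Bürgisser
(*Cook's versus Valiant's hypothesis*, TCS 235 (2000), Lemma 4.3 and Thm. 4.5, p. 80–82) imports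
from Bézout's inequality and from Krick–Pardo's arithmetic Nullstellensatz. It follows the IDEA of
Canny's *generalised characteristic polynomial* (J. Symbolic Comput. 9 (1990), §2–3: perturb `f_i`
to `f_i + s·x_i^{d_i}`, regard the characteristic polynomial of the perturbed — generically
non-degenerate — system as a polynomial in the perturbation parameter `s`, and read off its extreme
coefficient), but replaces Canny's Macaulay matrix by a naive TRIANGULAR REWRITING matrix, for
which everything needed is proved here from scratch (no resultants, no Gröbner bases, no Hilbert
functions, no degree theory of varieties).

## Part 1 — triangular rewriting (`[folklore]` linear algebra)

Let `R` be a commutative ring, `D ≥ 1`, and `T_1, …, T_n ∈ R[X_1, …, X_n]` of total degree `< D`;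
put `G_i = X_i^D - T_i` (the top-degree form of `G_i` is `X_i^D`). Rewriting a monomial `X^α` with
some `α_i ≥ D` (the least such `i`) into `X^{α - D e_i} · T_i` does not change its value at any
common zero of the `G_i` and strictly lowers the degree of the non-reduced part; after enough
passes every polynomial becomes a combination of the `Dⁿ` BOX monomials `X^β`, `0 ≤ β_i < D`. For a
polynomial `u` the `Dⁿ × Dⁿ` matrix `M_u` whose column `β` lists the box coefficients of the
rewritten `u · X^β` is the *rewriting matrix* of multiplication by `u`.

* `IsBox`, `boxExp`, `rewriteExp`, `reduceStep`, `DegBound`, `rewriteMatrix`; `aeval_reduceStep`,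
  `degBound_reduceStep`, `isBox_of_iterate`, `reduceStep_map`, `rewriteMatrix_map`.
* **`eval_charpoly_rewriteMatrix_eq_zero`** — for every common zero `x` of the `G_i` in a domain
  `S ⊇ R`, `u(x)` is a root of the characteristic polynomial of `M_u`: the vector `(x^β)_β` is a
  left eigenvector of `M_u` for the eigenvalue `u(x)` and `x^0 = 1 ≠ 0`. NO linear independence of
  the box monomials modulo `(G_1, …, G_n)` (no Gröbner or Macaulay-type statement) is needed — only
  that each rewriting step is correct modulo the ideal.

## Part 2 — the perturbed characteristic polynomial, the limit lemma, the count

For `F_1, …, F_n ∈ R[X_1, …, X_n]` of total degree `< D` consider over `R[s]` the triangular system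
`G^s_i = X_i^D + s F_i` (`pertTail`) and the characteristic polynomial `P_u(s, T) ∈ R[s][T]`
(`pertCharpoly`) of the rewriting matrix of multiplication by `u`; its *leading `s`-form*
`Q_u(T) = sLead P_u ∈ R[T]` is the coefficient of the highest power of `s` occurring in `P_u`.

* `sLead_ne_zero`, `natDegree_sLead_pertCharpoly_le` — `Q_u ≠ 0` (for `R` nontrivial), `deg Q_u ≤ Dⁿ`.
* `eval_map_pertCharpoly_eq_zero` — for every value `s₀` and every common zero `x` of the
  specialised system `X_i^D + s₀ F_i`: `P_u(s₀, u(x)) = 0`.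
* **`eval_sLead_pertCharpoly_eq_zero` (the limit lemma)** — over an algebraically closed field `K`:
  if the zero set `Z(F) ⊆ Kⁿ` of the UNPERTURBED system is finite then `Q_u(u(z)) = 0` for every
  `z ∈ Z(F)`. Proof (the algebraic form of "let `ε = 1/s → 0` along a bounded branch"): in
  `A = K[ε, X]` let `I = (ε X_i^D + F_i)`; a minimal prime `𝔭 ⊆ 𝔪_{(0,z)}` of `I` has height
  `≤ n` (Krull), so `ε ∉ 𝔭` — otherwise `Z(𝔭) ⊆ {0} × Z(F)` is finite, forcing `𝔭 = 𝔪_{(0,z)}`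
  of height `n + 1` (dimension formula for affine domains); and `ε · Φ'`, `Φ' = Σ_k Σ_j c_{kj}
  ε^{N-j} u^k` the `ε`-homogenised reverse of `P_u` (`N = deg_s P_u`), vanishes on `Z(I)` by the
  eigenvalue property at `s₀ = 1/ε`, hence lies in `√I ⊆ 𝔭` (Nullstellensatz); so
  `Φ' ∈ 𝔭 ⊆ 𝔪_{(0,z)}`, i.e. `Q_u(u(z)) = Φ'(0, z) = 0`.
* **`card_zeros_le_pow` (Bézout-type count)** — a finite zero set of `n` polynomials of degree
  `< D` in `n` variables over an algebraically closed field has at most `Dⁿ` points (separate the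
  points by a linear form `u`; they give distinct roots of `Q_u`).

The height bounds for `Q_u` over `ℤ` (Bürgisser's "`log wt = d^{O(n)} log w`") are in a sequel.

## References

* J. Canny, *Generalised characteristic polynomials*, J. Symbolic Comput. 9 (1990) 241–250,
  §2 (GCP) and Thm. 3.2. [Canny1990GCP]
* P. Bürgisser, *Cook's versus Valiant's hypothesis*, Theoret. Comput. Sci. 235 (2000) 71–88,
  Lemma 4.3 and Thm. 4.5 (p. 80–82). [Burgisser2000TCS]
-/


noncomputable section

open MvPolynomial Finsupp
open scoped Pointwise

namespace Literature.RingTheory.Elimination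

variable {R : Type*} [CommRing R] {n D : ℕ}

/-! ### Box exponents -/

/-- `IsBox D α`: every exponent of the monomial `X^α` is `< D` (a "box" or reduced monomial for
the triangular system `X_i^D - T_i`). [folklore] -/
def IsBox (D : ℕ) (α : Fin n →₀ ℕ) : Prop := ∀ i, α i < D

/-- `IsBox` is decidable. [folklore] -/
instance instDecidableIsBox (D : ℕ) (α : Fin n →₀ ℕ) : Decidable (IsBox D α) := by
  unfold IsBox; infer_instance

/-- The exponent vector of a box index `b : Fin n → Fin D`. [folklore] -/
def boxExp (b : Fin n → Fin D) : Fin n →₀ ℕ :=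
  Finsupp.equivFunOnFinite.symm fun i => (b i : ℕ)

/-- Components of `boxExp`. [folklore] -/
@[simp] theorem boxExp_apply (b : Fin n → Fin D) (i : Fin n) : boxExp b i = b i := by
  simp [boxExp]

/-- Box indices have box exponents. [folklore] -/
theorem isBox_boxExp (b : Fin n → Fin D) : IsBox D (boxExp b) := fun i => by
  rw [boxExp_apply]; exact (b i).isLt

/-- `boxExp` is injective. [folklore] -/
theorem boxExp_injective : Function.Injective (boxExp (n := n) (D := D)) := by
  intro b b' h
  funext i
  apply Fin.ext
  have := congrArg (fun α => α i) h
  simpa using this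

/-- The box index of a box exponent. [folklore] -/
def toBox (α : Fin n →₀ ℕ) (h : IsBox D α) : Fin n → Fin D := fun i => ⟨α i, h i⟩

/-- `boxExp ∘ toBox = id` on box exponents. [folklore] -/
@[simp] theorem boxExp_toBox (α : Fin n →₀ ℕ) (h : IsBox D α) : boxExp (toBox α h) = α := by
  ext i; simp [toBox]

/-- A box exponent is in the range of `boxExp`. [folklore] -/
theorem mem_image_boxExp_of_isBox {α : Fin n →₀ ℕ} (h : IsBox D α) :
    α ∈ (Finset.univ : Finset (Fin n → Fin D)).image boxExp :=
  Finset.mem_image.2 ⟨toBox α h, Finset.mem_univ _, boxExp_toBox α h⟩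

/-- The degree `|α| = Σ α_i` of an exponent vector, as used by `MvPolynomial.totalDegree`. [folklore] -/
theorem degree_eq_sum_id (α : Fin n →₀ ℕ) : degree α = α.sum fun _ e => e := by
  simp [degree_apply, Finsupp.sum]

/-! ### One rewriting pass -/

/-- Rewriting of the single monomial `X^α`: if some `α_i ≥ D`, with `i` least, replace `X^α` by
`X^{α - D e_i} · T_i`; otherwise keep `X^α`. [folklore] -/
def rewriteExp (D : ℕ) (T : Fin n → MvPolynomial (Fin n) R) (α : Fin n →₀ ℕ) :
    MvPolynomial (Fin n) R :=
  if h : ∃ i, D ≤ α i then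
    monomial (α - Finsupp.single (Fin.find _ h) D) 1 * T (Fin.find _ h)
  else monomial α 1

/-- One rewriting pass: rewrite every monomial of `p` once. [folklore] -/
def reduceStep (D : ℕ) (T : Fin n → MvPolynomial (Fin n) R) (p : MvPolynomial (Fin n) R) :
    MvPolynomial (Fin n) R :=
  ∑ α ∈ p.support, C (coeff α p) * rewriteExp D T α

/-- No exponent is `≥ D` iff the exponent vector is a box exponent. [folklore] -/
theorem not_exists_le_iff_isBox (α : Fin n →₀ ℕ) : (¬ ∃ i, D ≤ α i) ↔ IsBox D α := by
  simp [IsBox, not_le]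

/-- Box monomials are not rewritten. [folklore] -/
theorem rewriteExp_of_isBox (T : Fin n → MvPolynomial (Fin n) R) {α : Fin n →₀ ℕ}
    (h : IsBox D α) : rewriteExp D T α = monomial α 1 := by
  unfold rewriteExp
  rw [dif_neg ((not_exists_le_iff_isBox α).2 h)]

/-- A polynomial all of whose monomials are box monomials is not changed by a rewriting pass.
[folklore] -/
theorem reduceStep_eq_self_of_isBox (T : Fin n → MvPolynomial (Fin n) R)
    {p : MvPolynomial (Fin n) R} (h : ∀ α ∈ p.support, IsBox D α) : reduceStep D T p = p := by
  unfold reduceStep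
  conv_rhs => rw [← support_sum_monomial_coeff p]
  refine Finset.sum_congr rfl fun α hα => ?_
  rw [rewriteExp_of_isBox T (h α hα), C_mul_monomial, mul_one]

section Eval

variable {S : Type*} [CommRing S] [Algebra R S]

/-- At a common zero `x` of the `X_i^D - T_i` (i.e. `x_i^D = T_i(x)`), rewriting a monomial does not
change its value. [folklore] -/
theorem aeval_rewriteExp (T : Fin n → MvPolynomial (Fin n) R) (x : Fin n → S)
    (hx : ∀ i, x i ^ D = aeval x (T i)) (α : Fin n →₀ ℕ) :
    aeval x (rewriteExp D T α) = aeval x (monomial α (1 : R)) := by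
  unfold rewriteExp
  split_ifs with h
  · set i := Fin.find _ h with hi
    have hle : D ≤ α i := Fin.find_spec h
    have hsingle : Finsupp.single i D ≤ α := Finsupp.single_le_iff.2 hle
    calc aeval x (monomial (α - Finsupp.single i D) (1 : R) * T i)
        = aeval x (monomial (α - Finsupp.single i D) (1 : R)) * x i ^ D := by rw [map_mul, hx i]
      _ = aeval x (monomial (α - Finsupp.single i D) (1 : R) * X i ^ D) := by
          rw [map_mul, map_pow, aeval_X]
      _ = aeval x (monomial α (1 : R)) := by
          rw [X_pow_eq_monomial, monomial_mul, mul_one, tsub_add_cancel_of_le hsingle]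
  · rfl

/-- A rewriting pass does not change values at common zeros of the `X_i^D - T_i`. [folklore] -/
theorem aeval_reduceStep (T : Fin n → MvPolynomial (Fin n) R) (x : Fin n → S)
    (hx : ∀ i, x i ^ D = aeval x (T i)) (p : MvPolynomial (Fin n) R) :
    aeval x (reduceStep D T p) = aeval x p := by
  unfold reduceStep
  rw [map_sum]
  conv_rhs => rw [← support_sum_monomial_coeff p, map_sum]
  refine Finset.sum_congr rfl fun α _ => ?_
  rw [map_mul, aeval_rewriteExp T x hx, ← map_mul, C_mul_monomial, mul_one]

/-- Iterated rewriting passes do not change values at common zeros. [folklore] -/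
theorem aeval_iterate_reduceStep (T : Fin n → MvPolynomial (Fin n) R) (x : Fin n → S)
    (hx : ∀ i, x i ^ D = aeval x (T i)) (k : ℕ) (p : MvPolynomial (Fin n) R) :
    aeval x ((reduceStep D T)^[k] p) = aeval x p := by
  induction k generalizing p with
  | zero => rfl
  | succ k ih => rw [Function.iterate_succ_apply', aeval_reduceStep T x hx, ih]

end Eval

/-! ### Degree bookkeeping: the non-box part drops in degree -/

/-- `DegBound D p m`: every NON-box monomial of `p` has degree `< m`. [folklore] -/
def DegBound (D : ℕ) (p : MvPolynomial (Fin n) R) (m : ℕ) : Prop :=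
  ∀ α ∈ p.support, ¬ IsBox D α → degree α < m

/-- The trivial degree bound `deg p + 1`. [folklore] -/
theorem degBound_totalDegree (p : MvPolynomial (Fin n) R) : DegBound D p (p.totalDegree + 1) := by
  intro α hα _
  rw [degree_eq_sum_id]
  exact Nat.lt_succ_of_le (le_totalDegree hα)

/-- Degree bounds are monotone. [folklore] -/
theorem DegBound.mono {p : MvPolynomial (Fin n) R} {m m' : ℕ} (h : DegBound D p m) (hm : m ≤ m') :
    DegBound D p m' := fun α hα hb => lt_of_lt_of_le (h α hα hb) hm

/-- Degree bound `0` means: only box monomials. [folklore] -/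
theorem isBox_of_degBound_zero {p : MvPolynomial (Fin n) R} (h : DegBound D p 0) :
    ∀ α ∈ p.support, IsBox D α := by
  intro α hα
  by_contra hb
  exact Nat.not_lt_zero _ (h α hα hb)

/-- Support of the rewritten monomial in the non-box case: every monomial of
`X^{α - D e_i} · T_i` has degree `< |α|` when `deg T_i < D`. [folklore] -/
theorem degree_lt_of_mem_support_rewriteExp (T : Fin n → MvPolynomial (Fin n) R)
    (hT : ∀ i, (T i).totalDegree < D) {α : Fin n →₀ ℕ} (hα : ¬ IsBox D α)
    {β : Fin n →₀ ℕ} (hβ : β ∈ (rewriteExp D T α).support) : degree β < degree α := by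
  classical
  unfold rewriteExp at hβ
  have h : ∃ i, D ≤ α i := by
    by_contra h'; exact hα ((not_exists_le_iff_isBox α).1 h')
  rw [dif_pos h] at hβ
  set i := Fin.find _ h with hi
  have hle : D ≤ α i := Fin.find_spec h
  have hsingle : Finsupp.single i D ≤ α := Finsupp.single_le_iff.2 hle
  obtain ⟨γ, hγ, δ, hδ, rfl⟩ := Finset.mem_add.1 (support_mul _ _ hβ)
  have hγ' : γ = α - Finsupp.single i D := by
    have := support_monomial_subset hγ
    simpa using this
  subst hγ'
  have hdegδ : degree δ < D := by
    rw [degree_eq_sum_id]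
    exact lt_of_le_of_lt (le_totalDegree hδ) (hT i)
  have hsub : degree (α - Finsupp.single i D) + D = degree α := by
    conv_rhs => rw [← tsub_add_cancel_of_le hsingle]
    rw [map_add, degree_single]
  rw [map_add]
  omega

/-- One rewriting pass lowers the degree bound of the non-box part by one. [folklore] -/
theorem degBound_reduceStep (T : Fin n → MvPolynomial (Fin n) R) (hT : ∀ i, (T i).totalDegree < D)
    {p : MvPolynomial (Fin n) R} {m : ℕ} (h : DegBound D p (m + 1)) :
    DegBound D (reduceStep D T p) m := by
  classical
  intro β hβ hb
  unfold reduceStep at hβ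
  obtain ⟨α, hα, hβα⟩ := Finset.mem_biUnion.1 (support_sum hβ)
  have hβα' : β ∈ (rewriteExp D T α).support := by
    rw [C_mul'] at hβα
    exact MvPolynomial.support_smul hβα
  by_cases hbox : IsBox D α
  · rw [rewriteExp_of_isBox T hbox] at hβα'
    have : β = α := by simpa using support_monomial_subset hβα'
    exact absurd (this ▸ hbox) hb
  · have h1 := degree_lt_of_mem_support_rewriteExp T hT hbox hβα'
    have h2 := h α hα hbox
    omega

/-- After `m` passes a polynomial with non-box part of degree `< m` is reduced. [folklore] -/
theorem degBound_iterate (T : Fin n → MvPolynomial (Fin n) R) (hT : ∀ i, (T i).totalDegree < D)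
    (m : ℕ) : ∀ {p : MvPolynomial (Fin n) R}, DegBound D p m →
      DegBound D ((reduceStep D T)^[m] p) 0 := by
  induction m with
  | zero => intro p h; simpa using h
  | succ m ih =>
    intro p h
    rw [Function.iterate_succ_apply]
    exact ih (degBound_reduceStep T hT h)

/-- Passes beyond reduction change nothing. [folklore] -/
theorem iterate_eq_of_degBound_zero (T : Fin n → MvPolynomial (Fin n) R)
    {p : MvPolynomial (Fin n) R} (h : DegBound D p 0) (k : ℕ) : (reduceStep D T)^[k] p = p := by
  induction k with
  | zero => rfl
  | succ k ih =>
    rw [Function.iterate_succ_apply, reduceStep_eq_self_of_isBox T (isBox_of_degBound_zero h), ih]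

/-- **Termination**: after `k ≥ deg p + 1` rewriting passes only box monomials remain (any `k` at
least the degree bound of the non-box part will do). [folklore] -/
theorem isBox_of_iterate (T : Fin n → MvPolynomial (Fin n) R) (hT : ∀ i, (T i).totalDegree < D)
    {p : MvPolynomial (Fin n) R} {m k : ℕ} (h : DegBound D p m) (hk : m ≤ k) :
    ∀ α ∈ ((reduceStep D T)^[k] p).support, IsBox D α := by
  obtain ⟨j, rfl⟩ := Nat.exists_eq_add_of_le hk
  rw [add_comm, Function.iterate_add_apply]
  rw [iterate_eq_of_degBound_zero T (degBound_iterate T hT m h) j]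
  exact isBox_of_degBound_zero (degBound_iterate T hT m h)

/-! ### Compatibility with ring homomorphisms -/

section Map

variable {R' : Type*} [CommRing R'] (f : R →+* R')

/-- `rewriteExp` commutes with coefficient maps. [folklore] -/
theorem rewriteExp_map (T : Fin n → MvPolynomial (Fin n) R) (α : Fin n →₀ ℕ) :
    map f (rewriteExp D T α) = rewriteExp D (fun i => map f (T i)) α := by
  unfold rewriteExp
  split_ifs with h
  · rw [map_mul, map_monomial, map_one]
  · rw [map_monomial, map_one]

/-- Rewriting commutes with coefficient maps `R → R'` (the rewriting decisions depend only on the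
exponents). [folklore] -/
theorem reduceStep_map (T : Fin n → MvPolynomial (Fin n) R) (p : MvPolynomial (Fin n) R) :
    map f (reduceStep D T p) = reduceStep D (fun i => map f (T i)) (map f p) := by
  classical
  unfold reduceStep
  rw [map_sum]
  have h1 : ∀ α, map f (C (coeff α p) * rewriteExp D T α) =
      C (coeff α (map f p)) * rewriteExp D (fun i => map f (T i)) α := by
    intro α
    rw [map_mul, map_C, coeff_map, rewriteExp_map]
  simp_rw [h1]
  symm
  refine Finset.sum_subset (support_map_subset f p) ?_
  intro α _ hα
  have : coeff α (map f p) = 0 := by simpa [MvPolynomial.mem_support_iff] using hα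
  rw [this, C_0, zero_mul]

/-- Iterated rewriting commutes with coefficient maps. [folklore] -/
theorem iterate_reduceStep_map (T : Fin n → MvPolynomial (Fin n) R) (k : ℕ)
    (p : MvPolynomial (Fin n) R) :
    map f ((reduceStep D T)^[k] p) = (reduceStep D (fun i => map f (T i)))^[k] (map f p) := by
  induction k generalizing p with
  | zero => rfl
  | succ k ih => rw [Function.iterate_succ_apply', Function.iterate_succ_apply', reduceStep_map, ih]

end Map

/-! ### The rewriting matrix and its eigenvalue property -/

/-- The **rewriting matrix** of multiplication by `u` (after `k` passes): column `β` holds the box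
coefficients of the rewritten `u · X^β`. [folklore] -/
def rewriteMatrix (D : ℕ) (T : Fin n → MvPolynomial (Fin n) R) (u : MvPolynomial (Fin n) R)
    (k : ℕ) : Matrix (Fin n → Fin D) (Fin n → Fin D) R :=
  Matrix.of fun b' b => coeff (boxExp b') ((reduceStep D T)^[k] (u * monomial (boxExp b) 1))

/-- Entries of the rewriting matrix. [folklore] -/
theorem rewriteMatrix_apply (D : ℕ) (T : Fin n → MvPolynomial (Fin n) R)
    (u : MvPolynomial (Fin n) R) (k : ℕ) (b' b : Fin n → Fin D) :
    rewriteMatrix D T u k b' b =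
      coeff (boxExp b') ((reduceStep D T)^[k] (u * monomial (boxExp b) 1)) := rfl

/-- The rewriting matrix commutes with coefficient maps. [folklore] -/
theorem rewriteMatrix_map {R' : Type*} [CommRing R'] (f : R →+* R')
    (T : Fin n → MvPolynomial (Fin n) R) (u : MvPolynomial (Fin n) R) (k : ℕ) :
    (rewriteMatrix D T u k).map f = rewriteMatrix D (fun i => map f (T i)) (map f u) k := by
  ext b' b
  simp only [Matrix.map_apply, rewriteMatrix_apply]
  rw [← coeff_map, iterate_reduceStep_map, map_mul, map_monomial, map_one]

/-- Degree of a box exponent: `|β| ≤ n (D - 1)`. [folklore] -/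
theorem degree_boxExp_le (b : Fin n → Fin D) : degree (boxExp b) ≤ n * (D - 1) := by
  rw [degree_eq_sum, show n * (D - 1) = ∑ _i : Fin n, (D - 1) by simp]
  refine Finset.sum_le_sum fun i _ => ?_
  rw [boxExp_apply]
  have := (b i).isLt
  omega

/-- The products `u · X^β` have non-box part of degree `< deg u + n(D-1) + 1`. [folklore] -/
theorem degBound_mul_monomial (u : MvPolynomial (Fin n) R) (b : Fin n → Fin D) :
    DegBound D (u * monomial (boxExp b) 1) (u.totalDegree + n * (D - 1) + 1) := by
  refine (degBound_totalDegree _).mono ?_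
  have h1 := totalDegree_mul u (monomial (boxExp b) (1 : R))
  have h2 : (monomial (boxExp b) (1 : R)).totalDegree ≤ n * (D - 1) := by
    refine (totalDegree_monomial_le _ _).trans ?_
    have := degree_boxExp_le b
    rw [degree_eq_sum_id] at this
    exact this
  omega

section Eigen

variable {S : Type*} [CommRing S] [Algebra R S]

/-- Evaluation of a polynomial with box support as a sum over the box. [folklore] -/
theorem aeval_eq_sum_box (x : Fin n → S) {q : MvPolynomial (Fin n) R}
    (hq : ∀ α ∈ q.support, IsBox D α) :
    aeval x q = ∑ b : Fin n → Fin D,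
      algebraMap R S (coeff (boxExp b) q) * aeval x (monomial (boxExp b) (1 : R)) := by
  classical
  set g : (Fin n →₀ ℕ) → S :=
    fun α => algebraMap R S (coeff α q) * aeval x (monomial α (1 : R)) with hg
  have hsum : ∑ b : Fin n → Fin D, g (boxExp b) =
      ∑ α ∈ (Finset.univ : Finset (Fin n → Fin D)).image boxExp, g α := by
    rw [Finset.sum_image fun b _ b' _ h => boxExp_injective h]
  change aeval x q = ∑ b : Fin n → Fin D, g (boxExp b)
  rw [hsum]
  have hsub : q.support ⊆ (Finset.univ : Finset (Fin n → Fin D)).image boxExp :=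
    fun α hα => mem_image_boxExp_of_isBox (hq α hα)
  rw [← Finset.sum_subset hsub]
  · conv_lhs => rw [← support_sum_monomial_coeff q, map_sum]
    refine Finset.sum_congr rfl fun α _ => ?_
    rw [hg]
    dsimp only
    rw [show monomial α (coeff α q) = C (coeff α q) * monomial α (1 : R) by
      rw [C_mul_monomial, mul_one], map_mul, aeval_C]
  · intro α _ hα
    rw [hg]
    dsimp only
    have : coeff α q = 0 := by simpa [MvPolynomial.mem_support_iff] using hα
    rw [this, map_zero, zero_mul]

/-- **The eigenvalue property of the rewriting matrix.** Let `deg T_i < D` for all `i`, `0 < D`,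
and let `x ∈ Sⁿ` (`S ⊇ R` a domain) be a common zero of the `X_i^D - T_i`. Then for every
polynomial `u` and every `k ≥ deg u + n(D-1) + 1`, `u(x)` is a root of the characteristic
polynomial of the rewriting matrix `M_u`: indeed `(x^β)_β · M_u = u(x) · (x^β)_β` with
`x^0 = 1 ≠ 0`. (Canny 1990 §2 for the Macaulay matrix; here for triangular rewriting, where it
needs no independence of the box monomials.) [folklore] -/
theorem eval_charpoly_rewriteMatrix_eq_zero [IsDomain S] (hD : 0 < D) (T : Fin n → MvPolynomial (Fin n) R)
    (hT : ∀ i, (T i).totalDegree < D) (x : Fin n → S) (hx : ∀ i, x i ^ D = aeval x (T i))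
    (u : MvPolynomial (Fin n) R) {k : ℕ} (hk : u.totalDegree + n * (D - 1) + 1 ≤ k) :
    ((rewriteMatrix D T u k).charpoly.map (algebraMap R S)).eval (aeval x u) = 0 := by
  classical
  -- the (left) eigenvector relation for `φ = (x^β)_β`
  have key : ∀ b : Fin n → Fin D,
      ∑ b' : Fin n → Fin D, aeval x (monomial (boxExp b') (1 : R)) *
          algebraMap R S (rewriteMatrix D T u k b' b) =
        aeval x u * aeval x (monomial (boxExp b) (1 : R)) := by
    intro b
    have hbox := isBox_of_iterate T hT (degBound_mul_monomial u b) hk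
    have h := aeval_eq_sum_box (S := S) x hbox
    rw [aeval_iterate_reduceStep T x hx, map_mul] at h
    rw [h]
    refine Finset.sum_congr rfl fun b' _ => ?_
    rw [rewriteMatrix_apply, mul_comm]
  have hvec : Matrix.vecMul (fun b => aeval x (monomial (boxExp b) (1 : R)))
      ((rewriteMatrix D T u k).map (algebraMap R S)) =
        aeval x u • fun b => aeval x (monomial (boxExp b) (1 : R)) := by
    funext b
    simp only [Matrix.vecMul, dotProduct, Matrix.map_apply, Pi.smul_apply, smul_eq_mul]
    exact key b
  have hφ0 : (fun b : Fin n → Fin D => aeval x (monomial (boxExp b) (1 : R))) ≠ 0 := by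
    intro h0
    have h1 := congrFun h0 (fun _ => ⟨0, hD⟩)
    have : boxExp (fun _ : Fin n => (⟨0, hD⟩ : Fin D)) = 0 := by ext i; simp
    simp only [this, monomial_zero', map_one, Pi.zero_apply] at h1
    exact one_ne_zero h1
  have hdet : (Matrix.scalar (Fin n → Fin D) (aeval x u) -
      (rewriteMatrix D T u k).map (algebraMap R S)).det = 0 := by
    rw [← Matrix.exists_vecMul_eq_zero_iff]
    refine ⟨_, hφ0, ?_⟩
    rw [Matrix.vecMul_sub, hvec, Matrix.scalar_apply, Matrix.vecMul_diagonal_const]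
    funext b
    simp
  rw [← Matrix.charpoly_map, Matrix.eval_charpoly, hdet]

end Eigen

end Literature.RingTheory.Elimination

/-! ## Part 2 — the perturbed characteristic polynomial, the limit lemma and the count -/



open MvPolynomial Finsupp

namespace Literature.RingTheory.Elimination

variable {R : Type*} [CommRing R] {n D : ℕ}

/-! ### The leading `s`-form of a bivariate polynomial `P ∈ R[s][T]` -/

/-- `sDeg P`: the largest `s`-degree of a `T`-coefficient of `P ∈ R[s][T]`. [folklore] -/
def sDeg (P : Polynomial (Polynomial R)) : ℕ := P.support.sup fun k => (P.coeff k).natDegree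

/-- Every `T`-coefficient has `s`-degree `≤ sDeg P`. [folklore] -/
theorem natDegree_coeff_le_sDeg (P : Polynomial (Polynomial R)) (k : ℕ) :
    (P.coeff k).natDegree ≤ sDeg P := by
  by_cases hk : k ∈ P.support
  · exact Finset.le_sup (f := fun k => (P.coeff k).natDegree) hk
  · rw [Polynomial.notMem_support_iff.1 hk, Polynomial.natDegree_zero]; exact Nat.zero_le _

/-- `sLead P`: the polynomial in `T` formed by the coefficients of `s ^ sDeg P` — the leading
coefficient of `P` regarded as a polynomial in `s` over `R[T]`. [folklore] -/
def sLead (P : Polynomial (Polynomial R)) : Polynomial R :=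
  ∑ k ∈ P.support, Polynomial.monomial k ((P.coeff k).coeff (sDeg P))

/-- Coefficients of the leading `s`-form. [folklore] -/
theorem coeff_sLead (P : Polynomial (Polynomial R)) (k : ℕ) :
    (sLead P).coeff k = (P.coeff k).coeff (sDeg P) := by
  classical
  unfold sLead
  rw [Polynomial.finsetSum_coeff]
  simp only [Polynomial.coeff_monomial]
  rw [Finset.sum_ite_eq']
  split_ifs with h
  · rfl
  · rw [Polynomial.notMem_support_iff.1 h, Polynomial.coeff_zero]

/-- The leading `s`-form of a non-zero `P` is non-zero. [folklore] -/
theorem sLead_ne_zero {P : Polynomial (Polynomial R)} (hP : P ≠ 0) : sLead P ≠ 0 := by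
  classical
  obtain ⟨k, hk, hmax⟩ := Finset.exists_max_image P.support (fun k => (P.coeff k).natDegree)
    (Polynomial.support_nonempty.2 hP)
  have hdeg : sDeg P = (P.coeff k).natDegree :=
    le_antisymm (Finset.sup_le hmax) (Finset.le_sup (f := fun k => (P.coeff k).natDegree) hk)
  intro h0
  have h := coeff_sLead P k
  rw [h0, Polynomial.coeff_zero, hdeg, Polynomial.coeff_natDegree] at h
  exact (Polynomial.mem_support_iff.1 hk) (Polynomial.leadingCoeff_eq_zero.1 h.symm)

/-- `deg_T (sLead P) ≤ deg_T P`. [folklore] -/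
theorem natDegree_sLead_le (P : Polynomial (Polynomial R)) : (sLead P).natDegree ≤ P.natDegree := by
  unfold sLead
  refine Polynomial.natDegree_sum_le_of_forall_le _ _ fun k hk => ?_
  exact (Polynomial.natDegree_monomial_le _).trans (Polynomial.le_natDegree_of_mem_supp _ hk)

/-- `revEval P e t = Σ_k Σ_{j ≤ N} c_{kj} e^{N-j} t^k` (`N = sDeg P`, `c_{kj}` the coefficient of
`s^j T^k`): the value at `(e, t)` of the `e`-homogenised reverse `ε^N P(1/ε, T)`. [folklore] -/
def revEval (P : Polynomial (Polynomial R)) (e t : R) : R :=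
  ∑ k ∈ Finset.range (P.natDegree + 1), ∑ j ∈ Finset.range (sDeg P + 1),
    (P.coeff k).coeff j * e ^ (sDeg P - j) * t ^ k

/-- At `e = 0` the reverse evaluates to the leading `s`-form. [folklore] -/
theorem revEval_zero (P : Polynomial (Polynomial R)) (t : R) : revEval P 0 t = (sLead P).eval t := by
  unfold revEval
  have h1 : ∀ k, ∑ j ∈ Finset.range (sDeg P + 1),
      (P.coeff k).coeff j * (0 : R) ^ (sDeg P - j) * t ^ k = (P.coeff k).coeff (sDeg P) * t ^ k := by
    intro k
    rw [Finset.sum_eq_single (sDeg P)]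
    · simp
    · intro j hj hne
      have hj' : j < sDeg P := lt_of_le_of_ne (Nat.lt_succ_iff.1 (Finset.mem_range.1 hj)) hne
      rw [zero_pow (Nat.sub_ne_zero_of_lt hj'), mul_zero, zero_mul]
    · intro h; exact absurd (Finset.self_mem_range_succ _) h
  simp_rw [h1]
  rw [Polynomial.eval_eq_sum_range'
    (lt_of_le_of_lt (natDegree_sLead_le P) (Nat.lt_succ_self _))]
  simp_rw [coeff_sLead]

/-- For `e ≠ 0` in a field, `revEval P e t = e^N · P(e⁻¹)(t)`. [folklore] -/
theorem revEval_eq_of_ne_zero {K : Type*} [Field K] (P : Polynomial (Polynomial K)) {e : K}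
    (he : e ≠ 0) (t : K) :
    revEval P e t = e ^ sDeg P * (P.map (Polynomial.evalRingHom e⁻¹)).eval t := by
  rw [Polynomial.eval_map, Polynomial.eval₂_eq_sum_range' (Polynomial.evalRingHom e⁻¹)
    (Nat.lt_succ_self _)]
  unfold revEval
  rw [Finset.mul_sum]
  refine Finset.sum_congr rfl fun k _ => ?_
  rw [Polynomial.coe_evalRingHom,
    Polynomial.eval_eq_sum_range' (Nat.lt_succ_of_le (natDegree_coeff_le_sDeg P k)),
    Finset.sum_mul, Finset.mul_sum]
  refine Finset.sum_congr rfl fun j hj => ?_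
  have hj' : j ≤ sDeg P := Nat.lt_succ_iff.1 (Finset.mem_range.1 hj)
  have hpow : e ^ sDeg P * e⁻¹ ^ j = e ^ (sDeg P - j) := by
    rw [← pow_sub_mul_pow e hj', mul_assoc, ← mul_pow, mul_inv_cancel₀ he, one_pow, mul_one]
  rw [← hpow]
  ring

/-! ### The perturbed system `X_i^D + s F_i` over `R[s]` -/

/-- The tails `T_i = -(s · F_i)` of the perturbed triangular system `G^s_i = X_i^D - T_i =
X_i^D + s F_i` over `R[s]`. [cite: Canny1990GCP, §2] -/
def pertTail (F : Fin n → MvPolynomial (Fin n) R) (i : Fin n) : MvPolynomial (Fin n) (Polynomial R) :=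
  -(MvPolynomial.C Polynomial.X * MvPolynomial.map Polynomial.C (F i))

/-- `deg (C a · p) ≤ deg p`. [folklore] -/
theorem totalDegree_C_mul_le {σ : Type*} (a : R) (p : MvPolynomial σ R) :
    (MvPolynomial.C a * p).totalDegree ≤ p.totalDegree :=
  (totalDegree_mul _ _).trans (by rw [totalDegree_C, zero_add])

/-- `deg (map f p) ≤ deg p`. [folklore] -/
theorem totalDegree_map_le' {σ S : Type*} [CommRing S] (f : R →+* S) (p : MvPolynomial σ R) :
    (MvPolynomial.map f p).totalDegree ≤ p.totalDegree :=
  Finset.sup_mono (support_map_subset f p)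

/-- The perturbed tails have degree `≤ deg F_i`. [folklore] -/
theorem totalDegree_pertTail_le (F : Fin n → MvPolynomial (Fin n) R) (i : Fin n) :
    (pertTail F i).totalDegree ≤ (F i).totalDegree := by
  unfold pertTail
  rw [totalDegree_neg]
  exact (totalDegree_C_mul_le _ _).trans (totalDegree_map_le' _ _)

/-- Evaluation after the constant embedding is the identity. [folklore] -/
theorem evalRingHom_comp_C (s₀ : R) : (Polynomial.evalRingHom s₀).comp Polynomial.C = RingHom.id R := by
  ext r; simp

/-- Specialising `s ↦ s₀` in the perturbed tails gives `-(s₀ F_i)`. [folklore] -/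
theorem map_evalRingHom_pertTail (F : Fin n → MvPolynomial (Fin n) R) (s₀ : R) (i : Fin n) :
    MvPolynomial.map (Polynomial.evalRingHom s₀) (pertTail F i) = -(MvPolynomial.C s₀ * F i) := by
  unfold pertTail
  rw [map_neg, map_mul, map_C, Polynomial.coe_evalRingHom, Polynomial.eval_X, map_map,
    evalRingHom_comp_C, map_id]

/-- The perturbed rewriting matrix of multiplication by `u`, over `R[s]`. [cite: Canny1990GCP, §2] -/
def pertMatrix (D : ℕ) (F : Fin n → MvPolynomial (Fin n) R) (u : MvPolynomial (Fin n) R) (k : ℕ) :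
    Matrix (Fin n → Fin D) (Fin n → Fin D) (Polynomial R) :=
  rewriteMatrix D (pertTail F) (MvPolynomial.map Polynomial.C u) k

/-- **The perturbed characteristic polynomial** `P_u(s, T) ∈ R[s][T]` of multiplication by `u`
modulo `X_i^D + s F_i` (outer variable `T`, inner variable `s`). [cite: Canny1990GCP, §2] -/
def pertCharpoly (D : ℕ) (F : Fin n → MvPolynomial (Fin n) R) (u : MvPolynomial (Fin n) R) (k : ℕ) :
    Polynomial (Polynomial R) :=
  (pertMatrix D F u k).charpoly

/-- The perturbed characteristic polynomial is monic, hence non-zero. [folklore] -/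
theorem pertCharpoly_ne_zero [Nontrivial R] (D : ℕ) (F : Fin n → MvPolynomial (Fin n) R)
    (u : MvPolynomial (Fin n) R) (k : ℕ) : pertCharpoly D F u k ≠ 0 :=
  (Matrix.charpoly_monic _).ne_zero

/-- `deg_T P_u = Dⁿ` (the size of the box). [folklore] -/
theorem natDegree_pertCharpoly [Nontrivial R] (D : ℕ) (F : Fin n → MvPolynomial (Fin n) R)
    (u : MvPolynomial (Fin n) R) (k : ℕ) : (pertCharpoly D F u k).natDegree = D ^ n := by
  unfold pertCharpoly
  rw [Matrix.charpoly_natDegree_eq_dim, Fintype.card_fun, Fintype.card_fin, Fintype.card_fin]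

/-- `deg Q_u ≤ Dⁿ`. [cite: Canny1990GCP, Thm. 3.2] -/
theorem natDegree_sLead_pertCharpoly_le [Nontrivial R] (D : ℕ) (F : Fin n → MvPolynomial (Fin n) R)
    (u : MvPolynomial (Fin n) R) (k : ℕ) : (sLead (pertCharpoly D F u k)).natDegree ≤ D ^ n :=
  (natDegree_sLead_le _).trans (natDegree_pertCharpoly D F u k).le

/-- Specialisation `s ↦ s₀` of the perturbed matrix. [folklore] -/
theorem pertMatrix_map_evalRingHom (D : ℕ) (F : Fin n → MvPolynomial (Fin n) R)
    (u : MvPolynomial (Fin n) R) (k : ℕ) (s₀ : R) :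
    (pertMatrix D F u k).map (Polynomial.evalRingHom s₀) =
      rewriteMatrix D (fun i => -(MvPolynomial.C s₀ * F i)) u k := by
  unfold pertMatrix
  rw [rewriteMatrix_map]
  congr 1
  · funext i; exact map_evalRingHom_pertTail F s₀ i
  · rw [map_map, evalRingHom_comp_C, map_id]

/-- **Eigenvalue property of the specialised system**: if `x_i^D + s₀ F_i(x) = 0` for all `i`
(over a field) then `P_u(s₀, u(x)) = 0`. [cite: Canny1990GCP, §2] -/
theorem eval_map_pertCharpoly_eq_zero {K : Type*} [Field K] (hD : 0 < D)
    (F : Fin n → MvPolynomial (Fin n) K) (hF : ∀ i, (F i).totalDegree < D) (s₀ : K)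
    {x : Fin n → K} (hx : ∀ i, x i ^ D + s₀ * eval x (F i) = 0)
    (u : MvPolynomial (Fin n) K) {k : ℕ} (hk : u.totalDegree + n * (D - 1) + 1 ≤ k) :
    ((pertCharpoly D F u k).map (Polynomial.evalRingHom s₀)).eval (eval x u) = 0 := by
  have hT : ∀ i, (-(MvPolynomial.C s₀ * F i) : MvPolynomial (Fin n) K).totalDegree < D := fun i => by
    rw [totalDegree_neg]
    exact lt_of_le_of_lt (totalDegree_C_mul_le _ _) (hF i)
  have hx' : ∀ i, x i ^ D = aeval x (-(MvPolynomial.C s₀ * F i)) := fun i => by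
    rw [aeval_eq_eval, map_neg, map_mul, eval_C]
    linear_combination hx i
  have h := eval_charpoly_rewriteMatrix_eq_zero (S := K) hD _ hT x hx' u hk
  rw [Algebra.algebraMap_self, Polynomial.map_id, aeval_eq_eval] at h
  unfold pertCharpoly
  rw [← Matrix.charpoly_map, pertMatrix_map_evalRingHom]
  exact h

/-! ### The limit lemma -/

section Limit

variable {K : Type*} [Field K]

/-- Membership in the zero set of a square system. [folklore] -/
theorem mem_setOf_zeros_iff (F : Fin n → MvPolynomial (Fin n) K) (x : Fin n → K) :
    x ∈ {x : Fin n → K | ∀ i, eval x (F i) = 0} ↔ ∀ i, eval x (F i) = 0 := Iff.rfl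

/-- Height of the maximal ideal of a `K`-point of affine `(m)`-space: `m`. (Dimension formula for
the affine domain `K[X_1, …, X_m]`.) [folklore] -/
theorem height_vanishingIdeal_singleton {m : ℕ} (pt : Fin m → K) :
    (vanishingIdeal K ({pt} : Set (Fin m → K)) : Ideal (MvPolynomial (Fin m) K)).height = m := by
  have hdim := Literature.RingTheory.KrullDimension.ringKrullDim_quotient_add_height K
    (vanishingIdeal K ({pt} : Set (Fin m → K)) : Ideal (MvPolynomial (Fin m) K))
  have hdimA : ringKrullDim (MvPolynomial (Fin m) K) = (m : ℕ) := by
    rw [MvPolynomial.ringKrullDim_of_isNoetherianRing, ringKrullDim_eq_zero_of_field, zero_add,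
      Nat.card_eq_fintype_card, Fintype.card_fin]
  have hdimQ : ringKrullDim (MvPolynomial (Fin m) K ⧸
      (vanishingIdeal K ({pt} : Set (Fin m → K)) : Ideal (MvPolynomial (Fin m) K))) = 0 :=
    ringKrullDim_eq_zero_of_isField
      ((Ideal.Quotient.maximal_ideal_iff_isField_quotient _).1 inferInstance)
  rw [hdimQ, hdimA, zero_add] at hdim
  have : (((vanishingIdeal K ({pt} : Set (Fin m → K)) : Ideal (MvPolynomial (Fin m) K)).height :
      ℕ∞) : WithBot ℕ∞) = ((m : ℕ∞) : WithBot ℕ∞) := by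
    rw [hdim]; rfl
  exact WithBot.coe_injective this

/-- **The limit lemma** (Canny's GCP argument for triangular rewriting). Let `K` be algebraically
closed, `F_1, …, F_n ∈ K[X_1, …, X_n]` of total degree `< D`, `D ≥ 1`, with FINITE zero set
`Z(F)`. Then for every `z ∈ Z(F)` and every polynomial `u`, `u(z)` is a root of the leading
`s`-form `Q_u` of the perturbed characteristic polynomial: `Q_u(u(z)) = 0`.
[cite: Canny1990GCP, Thm. 3.2] -/
theorem eval_sLead_pertCharpoly_eq_zero [IsAlgClosed K] (hD : 0 < D)
    (F : Fin n → MvPolynomial (Fin n) K) (hF : ∀ i, (F i).totalDegree < D)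
    (hfin : {x : Fin n → K | ∀ i, eval x (F i) = 0}.Finite) {z : Fin n → K}
    (hz : ∀ i, eval z (F i) = 0) (u : MvPolynomial (Fin n) K) {k : ℕ}
    (hk : u.totalDegree + n * (D - 1) + 1 ≤ k) :
    (sLead (pertCharpoly D F u k)).eval (eval z u) = 0 := by
  classical
  set P := pertCharpoly D F u k with hP
  -- the ambient ring `A = K[ε, X_1, …, X_n]`, `ε = X 0`, `X_i ↦ X i.succ`
  have hι : ∀ (p : Fin (n + 1) → K) (q : MvPolynomial (Fin n) K),
      eval p (rename Fin.succ q) = eval (Fin.tail p) q := by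
    intro p q; rw [eval_rename]; rfl
  set G : Fin n → MvPolynomial (Fin (n + 1)) K :=
    fun i => X 0 * rename Fin.succ (X i) ^ D + rename Fin.succ (F i) with hG
  set I : Ideal (MvPolynomial (Fin (n + 1)) K) := Ideal.span (Set.range G) with hI
  have hZI : ∀ p ∈ zeroLocus K I, ∀ i, p 0 * p (Fin.succ i) ^ D + eval (Fin.tail p) (F i) = 0 := by
    intro p hp i
    rw [zeroLocus_span] at hp
    have h := hp (G i) ⟨i, rfl⟩
    rwa [aeval_eq_eval, hG, map_add, map_mul, map_pow, eval_X, hι, hι, eval_X] at h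
  -- the element `Φ'` and `ε Φ' ∈ √I`
  set Φ' : MvPolynomial (Fin (n + 1)) K :=
    ∑ k ∈ Finset.range (P.natDegree + 1), ∑ j ∈ Finset.range (sDeg P + 1),
      MvPolynomial.C ((P.coeff k).coeff j) * X 0 ^ (sDeg P - j) * rename Fin.succ u ^ k with hΦ'def
  have hΦ' : ∀ p : Fin (n + 1) → K, eval p Φ' = revEval P (p 0) (eval (Fin.tail p) u) := by
    intro p
    simp only [hΦ'def, revEval, map_sum, map_mul, map_pow, eval_C, eval_X, hι]
  have hvan : X 0 * Φ' ∈ vanishingIdeal K (zeroLocus K I) := by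
    intro p hp
    rw [aeval_eq_eval, map_mul, eval_X, hΦ']
    by_cases h0 : p 0 = 0
    · rw [h0, zero_mul]
    · have hx : ∀ i, (Fin.tail p) i ^ D + (p 0)⁻¹ * eval (Fin.tail p) (F i) = 0 := by
        intro i
        have h := hZI p hp i
        have : (p 0)⁻¹ * (p 0 * p (Fin.succ i) ^ D + eval (Fin.tail p) (F i)) = 0 := by
          rw [h, mul_zero]
        rw [mul_add, ← mul_assoc, inv_mul_cancel₀ h0, one_mul] at this
        exact this
      rw [revEval_eq_of_ne_zero P h0, eval_map_pertCharpoly_eq_zero hD F hF (p 0)⁻¹ hx u hk,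
        mul_zero, mul_zero]
  have hrad : X 0 * Φ' ∈ I.radical := by
    rw [← vanishingIdeal_zeroLocus_eq_radical (K := K)]; exact hvan
  -- the point `(0, z)`, its maximal ideal, and a minimal prime of `I` below it
  set pt : Fin (n + 1) → K := Fin.cons 0 z with hpt
  have hpt0 : pt 0 = 0 := by rw [hpt]; exact Fin.cons_zero _ _
  have hptt : Fin.tail pt = z := by rw [hpt]; exact Fin.tail_cons _ _
  set 𝔪 : Ideal (MvPolynomial (Fin (n + 1)) K) := vanishingIdeal K ({pt} : Set (Fin (n + 1) → K))
    with h𝔪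
  haveI h𝔪max : 𝔪.IsMaximal := by rw [h𝔪]; infer_instance
  have hI𝔪 : I ≤ 𝔪 := by
    rw [hI, Ideal.span_le]
    rintro _ ⟨i, rfl⟩
    rw [SetLike.mem_coe, h𝔪, mem_vanishingIdeal_singleton_iff, aeval_eq_eval, hG]
    dsimp only
    rw [map_add, map_mul, map_pow, eval_X, hι, hι, eval_X, hpt0, hptt, hz i, zero_mul, zero_add]
  obtain ⟨𝔭, h𝔭min, h𝔭𝔪⟩ := Ideal.exists_minimalPrimes_le hI𝔪
  have h𝔭prime : 𝔭.IsPrime := h𝔭min.1.1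
  have hI𝔭 : I ≤ 𝔭 := h𝔭min.1.2
  -- Krull's height theorem: `ht 𝔭 ≤ n`
  have hht : 𝔭.height ≤ n := by
    have h1 : I = Ideal.span (((Finset.univ : Finset (Fin n)).image G : Finset _) : Set _) := by
      rw [hI, Finset.coe_image, Finset.coe_univ, Set.image_univ]
    have h2 : 𝔭 ∈ (Ideal.span (((Finset.univ : Finset (Fin n)).image G : Finset _) :
        Set (MvPolynomial (Fin (n + 1)) K))).minimalPrimes := h1 ▸ h𝔭min
    refine (Ideal.height_le_card_of_mem_minimalPrimes_span_finset h2).trans ?_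
    exact_mod_cast Finset.card_image_le.trans (by simp)
  -- `ε ∉ 𝔭`: otherwise `Z(𝔭) = {pt}`, `𝔭 = 𝔪` has height `n + 1`
  have hε : (X 0 : MvPolynomial (Fin (n + 1)) K) ∉ 𝔭 := by
    intro hε
    have hZ𝔭 : zeroLocus K 𝔭 ⊆
        (fun x : Fin n → K => (Fin.cons 0 x : Fin (n + 1) → K)) ''
          {x : Fin n → K | ∀ i, eval x (F i) = 0} := by
      intro p hp
      have hp0 : p 0 = 0 := by
        have h := hp (X 0) hε
        rwa [aeval_eq_eval, eval_X] at h
      refine ⟨Fin.tail p, ?_, ?_⟩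
      · intro i
        have h := hZI p (zeroLocus_anti_mono hI𝔭 hp) i
        rwa [hp0, zero_mul, zero_add] at h
      · dsimp only
        rw [← hp0]
        exact Fin.cons_self_tail p
    have hfin𝔭 : (zeroLocus K 𝔭).Finite := (hfin.image _).subset hZ𝔭
    have hpt𝔭 : pt ∈ zeroLocus K 𝔭 := fun q hq =>
      (mem_vanishingIdeal_singleton_iff pt q).1 (by rw [← h𝔪]; exact h𝔭𝔪 hq)
    have hsingle : zeroLocus K 𝔭 = {pt} := by
      refine Set.eq_singleton_iff_unique_mem.2 ⟨hpt𝔭, fun p' hp' => ?_⟩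
      by_contra hne
      obtain ⟨j, hj⟩ := Function.ne_iff.1 hne
      set Tj : Finset K := hfin𝔭.toFinset.image (fun p => p j) with hTj
      have hab : (X j - MvPolynomial.C (pt j)) *
          ∏ c ∈ Tj.erase (pt j), (X j - MvPolynomial.C c) ∈ 𝔭 := by
        rw [← IsPrime.vanishingIdeal_zeroLocus (K := K) 𝔭]
        intro p hp
        rw [aeval_eq_eval, map_mul, map_prod]
        by_cases hpj : p j = pt j
        · rw [map_sub, eval_X, eval_C, hpj, sub_self, zero_mul]
        · have hmem : p j ∈ Tj.erase (pt j) :=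
            Finset.mem_erase.2 ⟨hpj, Finset.mem_image.2 ⟨p, hfin𝔭.mem_toFinset.2 hp, rfl⟩⟩
          rw [Finset.prod_eq_zero hmem (by rw [map_sub, eval_X, eval_C, sub_self]), mul_zero]
      rcases h𝔭prime.mem_or_mem hab with ha | hb
      · have h := hp' _ ha
        rw [aeval_eq_eval, map_sub, eval_X, eval_C, sub_eq_zero] at h
        exact hj h
      · have h := (mem_vanishingIdeal_singleton_iff pt _).1 (by rw [← h𝔪]; exact h𝔭𝔪 hb)
        rw [aeval_eq_eval, map_prod] at h
        obtain ⟨c, hc, hc0⟩ := Finset.prod_eq_zero_iff.1 h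
        rw [map_sub, eval_X, eval_C, sub_eq_zero] at hc0
        exact (Finset.mem_erase.1 hc).1 hc0.symm
    have h𝔭eq : 𝔭 = 𝔪 := by
      rw [← IsPrime.vanishingIdeal_zeroLocus (K := K) 𝔭, hsingle]
    have hh : 𝔪.height = (n + 1 : ℕ) := by
      rw [h𝔪]; exact height_vanishingIdeal_singleton pt
    rw [h𝔭eq, hh] at hht
    have : n + 1 ≤ n := by exact_mod_cast hht
    omega
  -- conclusion: `Φ' ∈ 𝔭 ⊆ 𝔪`, so `Φ'(pt) = Q_u(u(z)) = 0`
  have hΦ'𝔭 : Φ' ∈ 𝔭 := by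
    rcases h𝔭prime.mem_or_mem ((Ideal.IsPrime.radical_le_iff h𝔭prime).2 hI𝔭 hrad) with h | h
    · exact absurd h hε
    · exact h
  have h := (mem_vanishingIdeal_singleton_iff pt Φ').1 (by rw [← h𝔪]; exact h𝔭𝔪 hΦ'𝔭)
  rw [aeval_eq_eval, hΦ', hpt0, hptt, revEval_zero] at h
  exact h

/-- **Bézout-type count.** Over an algebraically closed field, a FINITE zero set of `n`
polynomials of total degree `< D` in `n` variables has at most `Dⁿ` points. (Separate the points by
a linear form `u`; by the limit lemma their `u`-values are roots of `Q_u ≠ 0`, `deg Q_u ≤ Dⁿ`.)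
Compare Bürgisser 2000 Lemma 4.3 / Bézout's inequality; Canny 1990 Thm. 3.2.
[cite: Canny1990GCP, Thm. 3.2] -/
theorem card_zeros_le_pow [IsAlgClosed K] (hD : 0 < D) (F : Fin n → MvPolynomial (Fin n) K)
    (hF : ∀ i, (F i).totalDegree < D) (hfin : {x : Fin n → K | ∀ i, eval x (F i) = 0}.Finite) :
    hfin.toFinset.card ≤ D ^ n := by
  classical
  set Z := hfin.toFinset with hZ
  -- a linear form separating the points of `Z`
  obtain ⟨c, hc⟩ : ∃ c : Fin n → K, ∀ p ∈ Z, ∀ q ∈ Z, p ≠ q → ∑ i, c i * (p i - q i) ≠ 0 := by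
    set Ψ : MvPolynomial (Fin n) K :=
      ∏ pq ∈ (Z ×ˢ Z).filter (fun pq => pq.1 ≠ pq.2), ∑ i, MvPolynomial.C (pq.1 i - pq.2 i) * X i
      with hΨ
    have hΨ0 : Ψ ≠ 0 := by
      rw [hΨ, Finset.prod_ne_zero_iff]
      intro pq hpq hzero
      obtain ⟨i, hi⟩ := Function.ne_iff.1 (Finset.mem_filter.1 hpq).2
      have h := congrArg (coeff (Finsupp.single i 1)) hzero
      rw [coeff_sum, coeff_zero, Finset.sum_eq_single i] at h
      · rw [coeff_C_mul, coeff_X, if_pos rfl, mul_one, sub_eq_zero] at h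
        exact hi h
      · intro b _ hb
        rw [coeff_C_mul, coeff_X,
          if_neg (by rw [Finsupp.single_left_inj one_ne_zero]; exact hb), mul_zero]
      · intro h; exact absurd (Finset.mem_univ i) h
    obtain ⟨c, hc⟩ : ∃ c : Fin n → K, eval c Ψ ≠ 0 := by
      by_contra h
      push Not at h
      exact hΨ0 (MvPolynomial.funext fun x => by rw [h x, map_zero])
    refine ⟨c, fun p hp q hq hpq => ?_⟩
    rw [hΨ, map_prod] at hc
    have h := Finset.prod_ne_zero_iff.1 hc (p, q) (Finset.mem_filter.2 ⟨Finset.mem_product.2 ⟨hp, hq⟩, hpq⟩)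
    simpa [map_sum, eval_C, eval_X, mul_comm] using h
  set u : MvPolynomial (Fin n) K := ∑ i, MvPolynomial.C (c i) * X i with hu
  set Q := sLead (pertCharpoly D F u (u.totalDegree + n * (D - 1) + 1)) with hQ
  have hQ0 : Q ≠ 0 := sLead_ne_zero (pertCharpoly_ne_zero _ _ _ _)
  have hroot : ∀ p ∈ Z, eval p u ∈ Q.roots.toFinset := by
    intro p hp
    rw [Multiset.mem_toFinset, Polynomial.mem_roots hQ0, Polynomial.IsRoot.def]
    exact eval_sLead_pertCharpoly_eq_zero hD F hF hfin (hfin.mem_toFinset.1 hp) u le_rfl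
  have hinj : Set.InjOn (fun p : Fin n → K => eval p u) Z := by
    intro p hp q hq hpq
    by_contra hne
    apply hc p hp q hq hne
    have : eval p u - eval q u = ∑ i, c i * (p i - q i) := by
      simp only [hu, map_sum, map_mul, eval_C, eval_X, ← Finset.sum_sub_distrib, mul_sub]
    rw [← this, sub_eq_zero]
    exact hpq
  calc Z.card ≤ Q.roots.toFinset.card := Finset.card_le_card_of_injOn _ hroot hinj
    _ ≤ Multiset.card Q.roots := Multiset.toFinset_card_le _
    _ ≤ Q.natDegree := Polynomial.card_roots' Q
    _ ≤ D ^ n := natDegree_sLead_pertCharpoly_le _ _ _ _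

end Limit

end Literature.RingTheory.Elimination
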